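import Mathlib
import Literature.AlgebraicGeometry.Ramification.InertiaDVRNormalSylow
import HarnessLib

/-!
# Inertia groups at points with a discrete valuation ring as local ring are p-closed (NpS in codimension one)

Scheme-level form of `InertiaDVRNormalSylow.lean`. Let a group `G` act on a scheme `X`
(`σ : G →* Aut X`) and let `x ∈ X` be a point whose local ring `𝒪_{X,x}` is a discrete valuation
ring of characteristic `p` (a point of codimension one on a normal scheme over `𝔽_p`). The
inertia group `I_x` (AS2011 2.4, the tree's `inertiaSubgroup σ x`: `g x = x` and `g` acts
trivially on `κ(x)`) acts on `𝒪_{X,x}` by local automorphisms inducing the identity on `κ(x)`;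
if this local action is faithful — automatic when `X` is integral, `G` acts faithfully and over
a separated base (`eq_one_of_fromSpecStalk_comp_eq`) — then `I_x` has a normal Sylow
`p`-subgroup (`hasNormalSylow_of_faithful_residueTrivial_action`). This is Serre, *Corps locaux*
IV §2 Cor. 4 / Abbes–Saito's (NpS) at codimension-one points, the input "the non-p-closed
locus of a `G`-action on a regular scheme has codimension `≥ 2`" of the inertia-stratum
analysis of wild quotient singularities.

Implementation: for `g ∈ I_x` the endomorphism `a_g = stalkSpecializes ≫ stalkMap` of `𝒪_{X,x}`
is characterised by `Spec(a_g) ≫ ι = ι ≫ g` where `ι : Spec 𝒪_{X,x} → X` is the canonical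
MONOMORPHISM (a preimmersion), so multiplicativity, invertibility and the residue condition all
follow by cancelling `ι` — no germ computations.

* `hasNormalSylow_inertiaSubgroup_of_stalk` — abstract form (faithfulness on `Spec 𝒪_{X,x}` as
  a hypothesis).
* `eq_one_of_fromSpecStalk_comp_eq` — that hypothesis holds for a faithful action on an integral
  scheme over a separated invariant base.
* `hasNormalSylow_inertiaSubgroup_of_isIntegral` — the combination.
-/

open CategoryTheory AlgebraicGeometry IsLocalRing

namespace Literature.AlgebraicGeometry.Ramification

universe u

variable {X : Scheme.{u}} {G : Type*} [Group G] (σ : G →* Aut X)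

/-- **Inertia groups at DVR points are p-closed** (abstract form). If `𝒪_{X,x}` is a discrete
valuation ring of characteristic `p`, the inertia group `I_x` is finite, and the action is
faithful on the local scheme `Spec 𝒪_{X,x} → X` (`ι ≫ g = ι ⇒ g = 1`), then `I_x` has a normal
Sylow `p`-subgroup. [cite: Serre1979, Ch. IV §2 Cor. 4] -/
theorem hasNormalSylow_inertiaSubgroup_of_stalk (p : ℕ) [Fact p.Prime] (x : X)
    [IsDomain (X.presheaf.stalk x)] [IsDiscreteValuationRing (X.presheaf.stalk x)]
    [CharP (X.presheaf.stalk x) p] [Finite (inertiaSubgroup σ x)]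
    (hfaith : ∀ g : G, X.fromSpecStalk x ≫ (σ g).hom = X.fromSpecStalk x → g = 1) :
    HasNormalSylow p (inertiaSubgroup σ x) := by
  classical
  set I := inertiaSubgroup σ x
  set F := X.fromSpecStalk x with hF
  have hfix : ∀ g : I, (σ (g : G)).hom.base x = x := fun g => apply_eq_of_mem_inertiaSubgroup σ g.2
  -- the stalk endomorphism of `g ∈ I`
  let a : I → (X.presheaf.stalk x ⟶ X.presheaf.stalk x) := fun g =>
    X.presheaf.stalkSpecializes (specializes_of_eq (hfix g)) ≫ (σ (g : G)).hom.stalkMap x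
  have hkey : ∀ g : I, Spec.map (a g) ≫ F = F ≫ (σ (g : G)).hom := by
    intro g
    simp only [a, hF]
    rw [Spec.map_comp, Category.assoc, Scheme.SpecMap_stalkSpecializes_fromSpecStalk,
      Scheme.SpecMap_stalkMap_fromSpecStalk]
  have hone : a 1 = 𝟙 _ := by
    apply Spec.map_injective
    rw [← cancel_mono F, hkey, Spec.map_id, Category.id_comp]
    simp
  have hmul : ∀ g h : I, a (g * h) = a g ≫ a h := by
    intro g h
    apply Spec.map_injective
    rw [← cancel_mono F, hkey, Spec.map_comp, Category.assoc, hkey, ← Category.assoc, hkey,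
      Category.assoc, Subgroup.coe_mul, map_mul, aut_mul_hom]
  have hinv₁ : ∀ g : I, a g ≫ a g⁻¹ = 𝟙 _ := fun g => by rw [← hmul, mul_inv_cancel, hone]
  have hinv₂ : ∀ g : I, a g⁻¹ ≫ a g = 𝟙 _ := fun g => by rw [← hmul, inv_mul_cancel, hone]
  -- as ring automorphisms: `E g := a g⁻¹` (to correct the variance)
  let E : I → (X.presheaf.stalk x ≃+* X.presheaf.stalk x) := fun g =>
    RingEquiv.ofRingHom (a g⁻¹).hom (a g).hom
      (by rw [← CommRingCat.hom_comp, hinv₁, CommRingCat.hom_id])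
      (by rw [← CommRingCat.hom_comp, hinv₂, CommRingCat.hom_id])
  have hE : ∀ (g : I) (y : X.presheaf.stalk x), E g y = (a g⁻¹).hom y := fun g y => rfl
  obtain ⟨τ, hτ⟩ : ∃ τ : I →* (X.presheaf.stalk x ≃+* X.presheaf.stalk x), ∀ g, τ g = E g :=
    ⟨{ toFun := E
       map_one' := by
         apply RingEquiv.ext; intro y
         rw [hE, inv_one, hone]; rfl
       map_mul' := fun g h => by
         apply RingEquiv.ext; intro y
         rw [RingAut.mul_apply, hE, hE, hE, mul_inv_rev, hmul, CommRingCat.hom_comp,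
           RingHom.comp_apply] }, fun g => rfl⟩
  -- faithful
  have hτinj : Function.Injective τ := by
    rw [injective_iff_map_eq_one]
    intro g hg
    have h1 : a g⁻¹ = 𝟙 _ := by
      ext y
      have := RingEquiv.congr_fun hg y
      rw [hτ, hE] at this
      simpa using this
    have h2 : F ≫ (σ ((g⁻¹ : I) : G)).hom = F := by rw [← hkey, h1, Spec.map_id, Category.id_comp]
    have h3 : ((g⁻¹ : I) : G) = 1 := hfaith _ h2
    have : (g⁻¹ : I) = 1 := Subtype.ext h3
    exact inv_eq_one.mp this
  -- residue-trivial
  have hres : ∀ (g : I) (y : X.presheaf.stalk x), τ g y - y ∈ maximalIdeal (X.presheaf.stalk x) := by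
    intro g y
    rw [hτ, hE]
    set k : I := g⁻¹
    -- `Spec κ(x) → X` is fixed by `σ k`, hence `a k ≫ residue = residue`
    have hk : X.fromSpecResidueField x ≫ (σ (k : G)).hom = X.fromSpecResidueField x :=
      (mem_inertiaSubgroup_iff σ).mp k.2
    have hk' : a k ≫ X.residue x = X.residue x := by
      apply Spec.map_injective
      rw [Spec.map_comp, ← cancel_mono F, Category.assoc, hkey, ← Category.assoc]
      exact hk
    have hval : (X.residue x).hom ((a k).hom y) = (X.residue x).hom y := by
      rw [← CommRingCat.comp_apply, hk']
    rw [← residue_eq_zero_iff, map_sub, sub_eq_zero]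
    exact hval
  exact hasNormalSylow_of_faithful_residueTrivial_action p τ hτinj hres

/-- **Faithfulness on the local scheme.** For an integral scheme `X`, a group action over a
separated base `r : X → Y` (`σ g ≫ r = r`) which is faithful (`σ` injective) is faithful on
every local scheme: if `Spec 𝒪_{X,x} → X ≫ σ g = Spec 𝒪_{X,x} → X` then `g = 1`, because
`Spec 𝒪_{X,x} → X` is dominant (its image contains the generic point) and `X` is reduced and
separated over `Y` (Mathlib `ext_of_isDominant_of_isSeparated`). [folklore] -/
theorem eq_one_of_fromSpecStalk_comp_eq [IsIntegral X] {Y : Scheme.{u}} (r : X ⟶ Y)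
    [IsSeparated r] (hr : ∀ g : G, (σ g).hom ≫ r = r) (hσ : Function.Injective σ) (x : X)
    (g : G) (h : X.fromSpecStalk x ≫ (σ g).hom = X.fromSpecStalk x) : g = 1 := by
  haveI : IsDominant (X.fromSpecStalk x) := by
    refine ⟨Dense.mono ?_ (dense_iff_closure_eq.mpr (genericPoint_spec X))⟩
    rintro _ ⟨⟩
    rw [Scheme.range_fromSpecStalk]
    exact (genericPoint_spec X).specializes (Set.mem_univ x)
  have hg : (σ g).hom = 𝟙 X :=
    ext_of_isDominant_of_isSeparated r (by rw [hr, Category.id_comp]) (X.fromSpecStalk x)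
      (by rw [h, Category.comp_id])
  apply hσ
  rw [map_one]
  exact Aut.ext hg

/-- **Inertia groups at codimension-one points of an integral `G`-scheme are p-closed**: `X`
integral with a finite group `G` acting faithfully over a separated base, `x ∈ X` a point whose
local ring is a discrete valuation ring of characteristic `p`; then `I_x` has a normal Sylow
`p`-subgroup (Serre IV §2 Cor. 4; AS2011 (NpS) in codimension one). [cite: Serre1979, Ch. IV §2 Cor. 4] -/
theorem hasNormalSylow_inertiaSubgroup_of_isIntegral (p : ℕ) [Fact p.Prime] [IsIntegral X]
    [Finite G] {Y : Scheme.{u}} (r : X ⟶ Y) [IsSeparated r] (hr : ∀ g : G, (σ g).hom ≫ r = r)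
    (hσ : Function.Injective σ) (x : X) [IsDiscreteValuationRing (X.presheaf.stalk x)]
    [CharP (X.presheaf.stalk x) p] : HasNormalSylow p (inertiaSubgroup σ x) :=
  hasNormalSylow_inertiaSubgroup_of_stalk σ p x
    (fun g hg => eq_one_of_fromSpecStalk_comp_eq σ r hr hσ x g hg)

end Literature.AlgebraicGeometry.Ramification
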